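import Literature.NumberTheory.GaloisCohomology.Howard2004.SelmerTriples
import Literature.NumberTheory.GaloisCohomology.Howard2004.FiniteSingularNatural
import Mathlib.Algebra.Colimit.Module
import Mathlib.RingTheory.DiscreteValuationRing.Basic
import Mathlib.RingTheory.Length
import HarnessLib

/-!
# Part B (cell pub/bsd-print-x9, (W9)-B): Howard 2004, Theorem 1.6.1 — the discrete valuation
ring Kolyvagin bound — as a CITE-ONLY named fact (REF-131 YES, typing conditions T1–T9)

Source: B. Howard, *The Heegner point Kolyvagin system*, Compositio Math. **140** (2004),
§1.6, Theorem 1.6.1 (= arXiv:1202.6340 §2.6, Thm. 2.6.1, p. 11 L13–32, proof p. 12 L29–55).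
«Throughout this subsection `R` is a fixed discrete valuation ring with uniformizing parameter
`π`.  Let `(T, F, 𝓛)` be a Selmer triple satisfying Hypotheses H.0–H.5, and suppose
`𝓛_s(T) ⊂ 𝓛` for `s ≫ 0`.  If `Φ` denotes the field of fractions of `R`, `𝒟 = Φ/R`, and
`A = T ⊗_R 𝒟`, then we obtain a Selmer structure on `A`, still denoted `F`, by propagating
`F ⊗ Φ` from `T ⊗ Φ` to `A`.»  **Theorem.** «Suppose there is a Kolyvagin system
`κ ∈ KS(T, F, 𝓛)` with `κ_1 ≠ 0`.  Then `H¹_F(K, T)` is a free rank-one `R` module, and there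
is a finite `R`-module `M` such that `H¹_F(K, A) ≅ 𝒟 ⊕ M ⊕ M`.  Furthermore
`len_R(M) ≤ len_R(H¹_F(K, T)/R·κ_1)`.»

TYPING (how each printed object is rendered; the vocabulary is `Howard2004/SelmerTriples.lean`):
* `T` (free of rank two over the DVR `R`, compact) = a π-adic tower `AdicTower K R N` whose level
  `k` presents `T/𝔪^{e_k} T` (`e` strictly increasing; Howard's own indexing is `e_k = k`), with
  the level rings `R_k = R/𝔪^{e_k}` (bound abstractly with their instances and pinned by a
  surjection `R → R_k` of kernel `𝔪^{e_k}`); `H¹_F(K, T) = lim_k H¹_F(K, T/𝔪^{e_k})`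
  [arXiv p. 12 L29] is `AdicTower.limitSelmer`.
* The hypotheses H.0, H.1, H.3, H.4, H.5 are imposed on EVERY level `(T^{(k)}, F, 𝓛^{(k)})` over
  `R_k` — «By Remark 1.3.1 [base change] the Selmer triple `(T^{(k)}, F, 𝓛^{(k)})` satisfies
  hypotheses H.0–H.5, and we may invoke the definitions and results of the preceding section»
  [arXiv p. 11 L33–38] — together with the compatibilities (local conditions, pairings, `θ`)
  that make the level data the reductions of data on `T`; H.2 (one field `F` for all levels) is
  the tower statement `H2Tower`.
* `𝓛 ⊂ 𝓛₀(T)`, `𝓛 ∩ Σ(F) = ∅`, `𝓛_s(T) ⊂ 𝓛` for `s ≥ s₀` are hypotheses (T5); `𝓛^{(k)} =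
  𝓛 ∩ 𝓛_{e_k}(T)`.
* `κ ∈ KS(T, F, 𝓛)` with `κ_1 ≠ 0` (Def. 1.2.3): for `R` a DVR, `I_n = 𝔪^{a(n)}` is open, so
  `T/I_nT = T^{(k)}/I_n T^{(k)}` for every level with `e_k ≥ a(n)`; `κ_n` is recorded as the
  level-compatible family of classes `κ^{(k)}_n ∈ H¹_{F(n)}(K, T^{(k)}/I_n) ⊗ G_n` (tranche-2
  `LevelData` at each level, reductions `rq`, compatibility `κ_red`), each level family being a
  Kolyvagin system for `(T^{(k)}, F, 𝓛)` (`LevelData.KS`, the (ks) relations) with the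
  finite–singular maps natural along the reductions (`fs_natural`), and `κ_1 ∈ H¹_F(K, T) = lim`
  (`KolyvaginSystem.one`, `one_mem`, `κ_one`), `κ_1 ≠ 0` a separate hypothesis of the fact (LEAD couplings (L4), (L5); referee T7).
  The finite–singular SLOTS `(LD k).fs` are PINNED to the comparison isomorphisms of Def. 1.1.8
  (`fs_admissible`, tranche 4: bijective on the finite classes and natural in the module,
  `LevelData.IsFsAdmissible`; reading note (v) of `FiniteSingularNatural.lean` records why this pin
  is faithful — without it a statement over all slots would be stronger than print).
* `H¹_F(K, A)`, `A = T ⊗ 𝒟 = colim_k T/𝔪^{e_k}` along multiplication by `π^{e_{k+1}-e_k}`: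
  the direct limit (Mathlib `AddCommGroup.DirectLimit`) of the `H¹(K, T/𝔪^{e_k})`, with the
  Selmer subgroup cut out by the PROPAGATION RECIPE of the source (T8): `F ⊗ Φ` pushed to `A` is,
  on `A[𝔪^{e_j}] = T/𝔪^{e_j}`, the preimage `{x | ι_{j→k} x ∈ F_k for some k ≥ j}` (`condA`).
* Conclusion: `H¹_F(K, T)` free of rank one = a generator with zero annihilator (`IsFreeRankOneOn`,
  scalars acting levelwise through x10b-p2's `scalarMapH1`); `M` a finite `R`-module with an
  additive `R`-equivariant bijection `H¹_F(K, A) ≃ 𝒟 × M × M`, `𝒟 = Frac(R)/R`; the length bound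
  as `len_R(M) ≤ len_R(R/r₁R)` where `κ_1 = r₁ · x` for the generator `x`.
READING NOTES for the referee: (1) the exponents `e_k` (any strictly increasing sequence; Howard
`e_k = k`) and the levelwise form of H.0–H.5 with compatibilities; (2) Zanarella 2019 (arXiv:1908.09197,
Thm. 2.21) restates the theorem with «both `(T, F)` and `(T*, F*)` satisfy (H.0)–(H.5)» and
`p > 4`; Howard's §1.6 preamble imposes H.0–H.5 on `(T, F, 𝓛)`; this file follows Howard and
records `p` odd (T2); (3) the reading notes (ii)–(iv) of `SelmerTriples.lean` apply, and reading
note (i) (the `fs` slot) is discharged by the field `SatisfiesH.fs_admissible` with reading note (v)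
of `FiniteSingularNatural.lean`.
NOTHING HERE IS PROVED: one named fact `thm161_dvrKolyvaginBound` (D-0026: the only new `def … :
Prop` without `_holds`), the rest are definitions with bodies.
-/

set_option autoImplicit false

noncomputable section

open Function NumberField IsDedekindDomain Field
open scoped NumberField ContRepresentation Classical

universe u

namespace Literature.NumberTheory.GaloisCohomology.Howard2004

open Literature.NumberTheory.GaloisRepresentations
open Literature.NumberTheory.GaloisRepresentations.DiscreteGaloisModule
open scoped TensorProduct

section DVR

variable {K : Type} [Field K] [NumberField K] {R : Type} [CommRing R]

namespace AdicTower

variable [IsLocalRing R] {N : ℕ → Type} [∀ k, AddCommGroup (N k)] [∀ k, TopologicalSpace (N k)]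
  [∀ k, DiscreteTopology (N k)] [∀ k, Module R (N k)]

/-- The scalar `r ∈ R` acting on a family `(x_k) ∈ Π_k H¹(K, T_k)` levelwise (x10b-p2's
`scalarMapH1`, the one scalar layer). [cite: Howard2004HeegnerKolyvagin, §1.6 (arXiv p. 12, L29)] -/
def smulFamily (T : AdicTower K R N) (r : R) (x : ∀ k, galoisCohomology (T.ρ k) 1) :
    ∀ k, galoisCohomology (T.ρ k) 1 :=
  fun k => galoisCohomology.scalarMapH1 (T.ρ k) (T.hlin k) r (x k)

/-- **«`H¹_F(K, T)` is a free rank-one `R` module»** generated by `x`: `x ∈ H¹_F(K, T)`, the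
annihilator of `x` is zero, and every element is a multiple of `x`.
[cite: Howard2004HeegnerKolyvagin, Thm. 1.6.1 (arXiv Thm. 2.6.1, p. 11, L25–26)] -/
def IsFreeRankOneOn (T : AdicTower K R N) (S : AddSubgroup (∀ k, galoisCohomology (T.ρ k) 1))
    (x : ∀ k, galoisCohomology (T.ρ k) 1) : Prop :=
  x ∈ S ∧ (∀ r : R, T.smulFamily r x = 0 → r = 0) ∧ ∀ y ∈ S, ∃ r : R, y = T.smulFamily r x

/-- **`𝓛₀(T)`** for the compact `T`: degree-two primes prime to `p` at which EVERY level is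
unramified. [cite: Howard2004HeegnerKolyvagin, §1.2 (arXiv p. 6, L54–56)] -/
def degreeTwoPrimes (p : ℕ) (T : AdicTower K R N) : Set (HeightOneSpectrum (𝓞 K)) :=
  ⋂ k, Howard2004.degreeTwoPrimes p (T.ρ k)

/-- **`𝓛_s(T)`** for the compact `T`: `ℓ ∈ 𝓛₀(T)` with `I_ℓ ⊂ p^s R`, i.e. `p^s ∣ ℓ + 1` in `R` and
`Frob_λ ≡ 1` on `T/p^s T` (on every level modulo `p^s`). [cite: Howard2004HeegnerKolyvagin, Def. 1.2.1 (arXiv p. 6, L63–68)] -/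
def kolyvaginPrimes (p : ℕ) (T : AdicTower K R N) (s : ℕ) : Set (HeightOneSpectrum (𝓞 K)) :=
  {v | v ∈ T.degreeTwoPrimes p ∧ ((residueChar v + 1 : ℕ) : R) ∈ Ideal.span {((p : ℕ) : R) ^ s} ∧
    ∀ (k : ℕ) (σ : absoluteGaloisGroup K), IsArithFrobAtPlace K v σ →
      ∀ x : N k, T.ρ k σ x - x ∈ (Ideal.span {((p : ℕ) : R) ^ s} • (⊤ : Submodule R (N k)) :
        Submodule R (N k))}

/-- **H.2 for the compact `T`**: ONE Galois extension `F/ℚ ⊃ K` with `G_F` acting trivially on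
every level `T/𝔪^{e_k} T` (i.e. on `T`) and `H¹(F(μ_{p^∞})/K, T̄) = 0` (as in `H2`).
[cite: Howard2004HeegnerKolyvagin, H.2 (arXiv p. 7, L61–63)] -/
def H2Tower (p : ℕ) (cd : ConjugationDatum K) (T : AdicTower K R N) {Nbar : Type}
    [AddCommGroup Nbar] [TopologicalSpace Nbar] [DiscreteTopology Nbar]
    (ρbar : DiscreteGaloisModule K Nbar) : Prop :=
  ∃ ΓF : Subgroup (absoluteGaloisGroup K), ΓF.Normal ∧ IsClosed (ΓF : Set (absoluteGaloisGroup K)) ∧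
    (∀ g ∈ ΓF, cd.conj g ∈ ΓF) ∧ (∀ k, ∀ g ∈ ΓF, ∀ x : N k, T.ρ k g x = x) ∧
    ∀ c : galoisCohomology ρbar 1,
      (resSubgroup (DiscreteGaloisModule.toTopRep ρbar)
          (ΓF ⊓ ⨅ n : ℕ, (DiscreteGaloisModule.mu K (p ^ n)).ker) 1).hom c = 0 → c = 0

section Colimit

variable (T : AdicTower K R N) (π : R) (e : ℕ → ℕ)
  (hkill : ∀ k, ∀ r ∈ IsLocalRing.maximalIdeal R ^ e k, ∀ x : N k, r • x = 0)
  (hker : ∀ k, LinearMap.ker (T.red k) = (IsLocalRing.maximalIdeal R ^ e k) • (⊤ : Submodule R (N (k + 1))))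
  (hπ : π ∈ IsLocalRing.maximalIdeal R) (he : ∀ k, e k ≤ e (k + 1))

/-- **`A[𝔪^{e_k}] ↪ A[𝔪^{e_{k+1}}]`** on the levels `T/𝔪^{e_k} → T/𝔪^{e_{k+1}}`: multiplication by
`π^{e_{k+1} - e_k}` on any lift (well defined: `𝔪^{e_k}` lifts die).  These are the transition
maps of `A = T ⊗ 𝒟 = colim_k T/𝔪^{e_k} T`. [cite: Howard2004HeegnerKolyvagin, §1.6 (arXiv p. 11 L18–20, p. 12 L40–48)] -/
def inc (k : ℕ) : N k →ₗ[R] N (k + 1) :=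
  ((LinearMap.ker (T.red k)).liftQ (π ^ (e (k + 1) - e k) • LinearMap.id) (by
      rw [hker k]
      refine Submodule.smul_le.mpr fun r hr x _ => ?_
      rw [LinearMap.mem_ker, LinearMap.smul_apply, LinearMap.id_apply, smul_smul]
      refine hkill (k + 1) _ ?_ x
      have h1 : π ^ (e (k + 1) - e k) ∈ IsLocalRing.maximalIdeal R ^ (e (k + 1) - e k) :=
        Ideal.pow_mem_pow hπ _
      have h2 := Ideal.mul_mem_mul h1 hr
      rwa [← pow_add, Nat.sub_add_cancel (he k)] at h2)).comp
    ((T.red k).quotKerEquivOfSurjective (T.red_surjective k)).symm.toLinearMap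

omit [NumberField K] in
/-- `inc (red y) = π^{e_{k+1}-e_k} · y`. [cite: Howard2004HeegnerKolyvagin, §1.6 (arXiv p. 12)] -/
theorem inc_red (k : ℕ) (y : N (k + 1)) :
    inc T π e hkill hker hπ he k (T.red k y) = π ^ (e (k + 1) - e k) • y := by
  have h1 : ((T.red k).quotKerEquivOfSurjective (T.red_surjective k)).symm (T.red k y) =
      Submodule.Quotient.mk y := by
    rw [LinearEquiv.symm_apply_eq]
    rfl
  simp [inc, h1]

omit [NumberField K] in
/-- `inc` is `Γ_K`-equivariant. [cite: Howard2004HeegnerKolyvagin, §1.6 (arXiv p. 12)] -/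
theorem inc_equivariant (k : ℕ) (g : absoluteGaloisGroup K) (x : N k) :
    inc T π e hkill hker hπ he k (T.ρ k g x) = T.ρ (k + 1) g (inc T π e hkill hker hπ he k x) := by
  obtain ⟨y, rfl⟩ := T.red_surjective k x
  rw [← T.red_equivariant, inc_red, inc_red, T.hlin (k + 1)]

/-- `H¹` of `inc` at a place `v` (local) — the maps along which `F ⊗ Φ` is pushed to `A`.
[cite: Howard2004HeegnerKolyvagin, §1.6 (arXiv p. 11, L18–20)] -/
def incLoc (k : ℕ) (v : Place K) :
    galoisCohomology ((T.ρ k).toLocal v) 1 →+ galoisCohomology ((T.ρ (k + 1)).toLocal v) 1 :=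
  ContinuousRep.cohomologyMap ((T.ρ k).toLocal v) ((T.ρ (k + 1)).toLocal v)
    (inc T π e hkill hker hπ he k).toAddMonoidHom continuous_of_discreteTopology
    (fun _ x => inc_equivariant T π e hkill hker hπ he k _ x) 1

/-- `H¹` of `inc` (global). [cite: Howard2004HeegnerKolyvagin, §1.6 (arXiv p. 12, L40–48)] -/
def incH1 (k : ℕ) : galoisCohomology (T.ρ k) 1 →+ galoisCohomology (T.ρ (k + 1)) 1 :=
  ContinuousRep.cohomologyMap (T.ρ k) (T.ρ (k + 1)) (inc T π e hkill hker hπ he k).toAddMonoidHom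
    continuous_of_discreteTopology (inc_equivariant T π e hkill hker hπ he k) 1

/-- Iterated local transition `H¹(K_v, T_j) → H¹(K_v, T_{j+d})`. [cite: Howard2004HeegnerKolyvagin, §1.6 (arXiv p. 11, L18–20)] -/
def incLocIter (j : ℕ) (v : Place K) :
    ∀ d : ℕ, galoisCohomology ((T.ρ j).toLocal v) 1 →+ galoisCohomology ((T.ρ (j + d)).toLocal v) 1
  | 0 => AddMonoidHom.id _
  | d + 1 => (incLoc T π e hkill hker hπ he (j + d) v).comp (incLocIter j v d)

/-- Transition `H¹(K, T_i) → H¹(K, T_j)` for `i ≤ j` (for Mathlib's `DirectLimit`).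
[cite: Howard2004HeegnerKolyvagin, §1.6 (arXiv p. 12, L40–48)] -/
def incH1LE (i j : ℕ) (h : i ≤ j) : galoisCohomology (T.ρ i) 1 →+ galoisCohomology (T.ρ j) 1 :=
  Nat.leRec (motive := fun j _ => galoisCohomology (T.ρ i) 1 →+ galoisCohomology (T.ρ j) 1)
    (AddMonoidHom.id _) (fun k _ g => (incH1 T π e hkill hker hπ he k).comp g) h

/-- **The Selmer structure `F` on `A[𝔪^{e_j}]`** (propagation recipe of the source: `F ⊗ Φ` on
`T ⊗ Φ` pushed to `A`, then pulled back to the finite submodule): a local class at level `j` is in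
`F` iff its image in some higher level lies in the (image-propagated) condition `F_k` there.
[cite: Howard2004HeegnerKolyvagin, §1.6 (arXiv p. 11, L18–20) with Def. 1.1.1 (arXiv p. 5, L20–24)] -/
def condA (F : ∀ k, SelmerStructure (T.ρ k)) (j : ℕ) : SelmerStructure (T.ρ j) :=
  fun v => ⨆ d : ℕ, (F (j + d) v).comap (incLocIter T π e hkill hker hπ he j v d)

/-- **`H¹(K, A) = colim_k H¹(K, A[𝔪^{e_k}])`** (Mathlib `AddCommGroup.DirectLimit`).
[cite: Howard2004HeegnerKolyvagin, §1.6 (arXiv p. 11 L18–20, p. 12 L40–48)] -/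
abbrev H1A : Type :=
  AddCommGroup.DirectLimit (fun k => galoisCohomology (T.ρ k) 1) (incH1LE T π e hkill hker hπ he)

/-- **`H¹_F(K, A) ⊂ H¹(K, A)`**: classes represented at some level by a Selmer class for the
propagated structure `condA`. [cite: Howard2004HeegnerKolyvagin, Thm. 1.6.1 (arXiv p. 11, L18–28)] -/
def selmerA (F : ∀ k, SelmerStructure (T.ρ k)) : AddSubgroup (H1A T π e hkill hker hπ he) :=
  ⨆ j, ((condA T π e hkill hker hπ he F j).selmerGroup).map
    (AddCommGroup.DirectLimit.of (fun k => galoisCohomology (T.ρ k) 1)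
      (incH1LE T π e hkill hker hπ he) j)

end Colimit

end AdicTower

/-- **`𝒟 = Φ/R`**, `Φ = Frac(R)`, as an `R`-module. [cite: Howard2004HeegnerKolyvagin, §1.6 (arXiv p. 11, L18–19)] -/
abbrev FracModR (R : Type) [CommRing R] [IsDomain R] : Type :=
  FractionRing R ⧸ (1 : Submodule R (FractionRing R))

/-! ## The setting of Theorem 1.6.1 (data) and its hypotheses -/

/-- **The data of Howard's §1.6**: a DVR `R` with uniformizer `π` (T1), its π-adic tower `T`
(levels `T^{(k)} = T/𝔪^{e_k}` with level rings `R_k = R/𝔪^{e_k}`), the complex conjugation datum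
(T3), `Σ(F)`, the Selmer triples `(T^{(k)}, F, 𝓛)` on the levels (T4), the prime set `𝓛` (T5),
the residual presentation `T̄` with its `G_ℚ`-structure and the duality data of H.4 on every
level (T6), and — for the Kolyvagin system (T7) — presentations of the quotients
`T^{(k)}/I_n T^{(k)} = T/(I_n + 𝔪^{e_k})T` at every level with their reductions
`T^{(k+1)}/I_n → T^{(k)}/I_n` (pinned by `rq_comp`), the finite–singular slots made natural across
levels (`fsQ`, pinned by `fsQ_spec` since the singular map is onto); the Kolyvagin system itself is
the separate structure `DVRSetting.KolyvaginSystem` (LEAD (L5)).  For `R` a DVR, `I_n = 𝔪^{a(n)}` (`ℓ + 1 ∈ I_ℓ` is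
non-zero), so `T/(I_n + 𝔪^{e_k}) = T/I_n T` as soon as `e_k ≥ a(n)`: the level-compatible family
`(κ^{(k)}_n)_k` IS Howard's `κ_n ∈ H¹_{F(n)}(K, T/I_nT) ⊗ G_n` read at every level (LEAD coupling
(L4): the same shape serves a compact `Λ`-adic `T`).  Types and instances are parameters.
[cite: Howard2004HeegnerKolyvagin, §1.6 (arXiv p. 11, L13–38) with Def. 1.2.3 (arXiv p. 7, L1–12)] -/
structure DVRSetting (p : ℕ) [Fact p.Prime] (K : Type) [Field K] [NumberField K]
    (R : Type) [CommRing R] [IsDomain R] [IsDiscreteValuationRing R] [Algebra ℤ_[p] R]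
    (N : ℕ → Type) [∀ k, AddCommGroup (N k)] [∀ k, TopologicalSpace (N k)]
    [∀ k, DiscreteTopology (N k)] [∀ k, Module R (N k)]
    (Rk : ℕ → Type) [∀ k, CommRing (Rk k)] [∀ k, IsLocalRing (Rk k)] [∀ k, TopologicalSpace (Rk k)]
    [∀ k, DiscreteTopology (Rk k)] [∀ k, Algebra ℤ_[p] (Rk k)] [∀ k, Algebra R (Rk k)]
    [∀ k, Module (Rk k) (N k)] [∀ k, IsScalarTower R (Rk k) (N k)]
    (Nbar : Type) [AddCommGroup Nbar] [TopologicalSpace Nbar] [DiscreteTopology Nbar]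
    [∀ k, Module (Rk k) Nbar]
    (Nq : ℕ → Finset (HeightOneSpectrum (𝓞 K)) → Type) [∀ k n, AddCommGroup (Nq k n)]
    [∀ k n, TopologicalSpace (Nq k n)] [∀ k n, DiscreteTopology (Nq k n)]
    [∀ k n, Module (Rk k) (Nq k n)] [∀ k n, Module R (Nq k n)]
    [∀ k n, IsScalarTower R (Rk k) (Nq k n)] where
  /-- uniformizer -/
  π : R
  /-- the exponents: level `k` is `T/𝔪^{e_k}` -/
  e : ℕ → ℕ
  /-- the tower `T` -/
  T : AdicTower K R N
  /-- complex conjugation -/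
  cd : ConjugationDatum K
  /-- a complex embedding of `K̄` (for the ring class fields of the transverse condition) -/
  jbar : AlgebraicClosure K →+* ℂ
  /-- `Σ(F)` -/
  Sigma : Finset (Place K)
  /-- the prime set `𝓛` -/
  L : Set (HeightOneSpectrum (𝓞 K))
  /-- the Selmer triple `(T^{(k)}, F, 𝓛)` on level `k` -/
  t : ∀ k, SelmerTriple p (T.ρ k)
  /-- residual representation `T̄` -/
  ρbar : DiscreteGaloisModule K Nbar
  /-- `T^{(k)} ↠ T̄` -/
  πbar : ∀ k, N k →ₗ[Rk k] Nbar
  /-- the `G_ℚ`-structure on `T̄` (H.5(a)), seen `R_k`-linearly at each level -/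
  A : ∀ k, ResidualTau (R := Rk k) cd ρbar
  /-- the duality data of H.4 on the levels -/
  D : ∀ k, DualityDatum p cd (T.ρ k) (Rk k)
  /-- the reductions `R_{k+1} → R_k` -/
  redR : ∀ k, Rk (k + 1) →+* Rk k
  /-- presentations of `T^{(k)}/I_n T^{(k)}` and the finite–singular slots at level `k` -/
  LD : ∀ k, LevelData (Rk k) (T.ρ k) (t k) (Nq k)
  /-- the reductions `T^{(k+1)}/I_n → T^{(k)}/I_n` -/
  rq : ∀ k n, Nq (k + 1) n →ₗ[R] Nq k n
  rq_comp : ∀ k n (x : N (k + 1)), rq k n ((LD (k + 1)).π n x) = (LD k).π n (T.red k x)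
  rq_equivariant : ∀ k n (g : absoluteGaloisGroup K) (y : Nq (k + 1) n),
    rq k n ((LD (k + 1)).ρq n g y) = (LD k).ρq n g (rq k n y)
  /-- the singular quotients along the reductions (pinned by `fsQ_spec`) -/
  fsQ : ∀ k n (v : HeightOneSpectrum (𝓞 K)),
    SingularQuotient (GaloisRep.toLocal v ((LD (k + 1)).ρq n)) →+
      SingularQuotient (GaloisRep.toLocal v ((LD k).ρq n))

namespace DVRSetting

variable {p : ℕ} [Fact p.Prime] {K : Type} [Field K] [NumberField K]
  {R : Type} [CommRing R] [IsDomain R] [IsDiscreteValuationRing R] [Algebra ℤ_[p] R]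
  {N : ℕ → Type} [∀ k, AddCommGroup (N k)] [∀ k, TopologicalSpace (N k)]
  [∀ k, DiscreteTopology (N k)] [∀ k, Module R (N k)]
  {Rk : ℕ → Type} [∀ k, CommRing (Rk k)] [∀ k, IsLocalRing (Rk k)] [∀ k, TopologicalSpace (Rk k)]
  [∀ k, DiscreteTopology (Rk k)] [∀ k, Algebra ℤ_[p] (Rk k)] [∀ k, Algebra R (Rk k)]
  [∀ k, Module (Rk k) (N k)] [∀ k, IsScalarTower R (Rk k) (N k)]
  {Nbar : Type} [AddCommGroup Nbar] [TopologicalSpace Nbar] [DiscreteTopology Nbar]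
  [∀ k, Module (Rk k) Nbar]
  {Nq : ℕ → Finset (HeightOneSpectrum (𝓞 K)) → Type} [∀ k n, AddCommGroup (Nq k n)]
  [∀ k n, TopologicalSpace (Nq k n)] [∀ k n, DiscreteTopology (Nq k n)]
  [∀ k n, Module (Rk k) (Nq k n)] [∀ k n, Module R (Nq k n)]
  [∀ k n, IsScalarTower R (Rk k) (Nq k n)]

/-- `H¹` of the reduction `T^{(k+1)}/I_n → T^{(k)}/I_n`. [cite: Howard2004HeegnerKolyvagin, §1.6 (arXiv p. 11, L49–50)] -/
def rqH1 (S : DVRSetting p K R N Rk Nbar Nq) (k : ℕ) (n : Finset (HeightOneSpectrum (𝓞 K))) :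
    galoisCohomology ((S.LD (k + 1)).ρq n) 1 →+ galoisCohomology ((S.LD k).ρq n) 1 :=
  ContinuousRep.cohomologyMap ((S.LD (k + 1)).ρq n) ((S.LD k).ρq n) (S.rq k n).toAddMonoidHom
    continuous_of_discreteTopology (S.rq_equivariant k n) 1

/-- The same on local cohomology at a finite place. [cite: Howard2004HeegnerKolyvagin, §1.6 (arXiv p. 11, L49–50)] -/
def rqLocH1 (S : DVRSetting p K R N Rk Nbar Nq) (k : ℕ) (n : Finset (HeightOneSpectrum (𝓞 K)))
    (v : HeightOneSpectrum (𝓞 K)) :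
    galoisCohomology (GaloisRep.toLocal v ((S.LD (k + 1)).ρq n)) 1 →+
      galoisCohomology (GaloisRep.toLocal v ((S.LD k).ρq n)) 1 :=
  ContinuousRep.cohomologyMap (GaloisRep.toLocal v ((S.LD (k + 1)).ρq n))
    (GaloisRep.toLocal v ((S.LD k).ρq n)) (S.rq k n).toAddMonoidHom
    continuous_of_discreteTopology (fun _ y => S.rq_equivariant k n _ y) 1

/-- **«`(T, F, 𝓛)` is a Selmer triple satisfying Hypotheses H.0–H.5» over the DVR `R`** (T1–T6 of
the referee's typing conditions, and the naturality of the finite–singular slots), clause by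
clause with its locator; `κ`-free (LEAD (L5)).
[cite: Howard2004HeegnerKolyvagin, §1.3 and §1.6 (arXiv p. 7 L55 – p. 8 L1; p. 11, L13–16)] -/
structure SatisfiesH (S : DVRSetting p K R N Rk Nbar Nq) : Prop where
  /-- T1: `R` is a coefficient ring (complete Noetherian local, finite residue field of char. `p`)
  [arXiv p. 4 L47–52]; a DVR by the instance. -/
  coeffRing : IsCoefficientRing p R
  /-- T2: `p` is odd [journal §1]. -/
  p_odd : p ≠ 2
  /-- T3: `K` is an imaginary quadratic field [arXiv p. 5, L3–4]. -/
  imagQuad : EllipticCurves.IsImaginaryQuadratic K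
  /-- `π` is a uniformizer [arXiv p. 11, L13–14]. -/
  unif : IsLocalRing.maximalIdeal R = Ideal.span {S.π}
  /-- the exponents increase strictly, `e_0 ≥ 1` (Howard: `e_k = k`) -/
  e_strictMono : StrictMono S.e
  e_zero : 0 < S.e 0
  /-- EXACT tower: level `k` IS `T/𝔪^{e_k}` — killed by `𝔪^{e_k}`, `ker(T^{(k+1)} → T^{(k)}) =
  𝔪^{e_k} T^{(k+1)}` -/
  killed : ∀ k, ∀ r ∈ IsLocalRing.maximalIdeal R ^ S.e k, ∀ x : N k, r • x = 0
  ker_red : ∀ k, LinearMap.ker (S.T.red k) =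
    (IsLocalRing.maximalIdeal R ^ S.e k) • (⊤ : Submodule R (N (k + 1)))
  /-- `R_k = R/𝔪^{e_k}`: the structure map is onto with kernel `𝔪^{e_k}`; `redR` is the reduction -/
  algebraMap_surjective : ∀ k, Function.Surjective (algebraMap R (Rk k))
  ker_algebraMap : ∀ k, RingHom.ker (algebraMap R (Rk k)) = IsLocalRing.maximalIdeal R ^ S.e k
  redR_comp : ∀ k (r : R), S.redR k (algebraMap R (Rk (k + 1)) r) = algebraMap R (Rk k) r
  /-- the action is `R_k`-linear on level `k` (`T^{(k)} ∈ Mod_{R_k, K}`) -/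
  scalarLinear : ∀ k, (S.T.ρ k).IsScalarLinear (Rk k)
  /-- H.0 on every level: `T^{(k)}` free of rank two over `R_k` [arXiv p. 7, L57] -/
  h0 : ∀ k, H0 (Rk k) (N k)
  /-- T4: `Σ(F)` is the same at every level; the local conditions are `R`-submodules
  [Def. 1.1.1, arXiv p. 5 L20–21] and level `k`'s are the reductions of level `k+1`'s
  (`F` on `T^{(k)}` propagated from `T`, Def. 1.1.3) -/
  Sigma_eq : ∀ k, (S.t k).Sigma = S.Sigma
  cond_smul : ∀ k (v : Place K) (r : R), (S.t k |>.cond v).map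
    (galoisCohomology.scalarMapH1 ((S.T.ρ k).toLocal v) ((S.T.hlin k).restrictField _) r) ≤
      (S.t k).cond v
  cond_red : ∀ k (v : Place K), ((S.t (k + 1)).cond v).map
      (ContinuousRep.cohomologyMap ((S.T.ρ (k + 1)).toLocal v) ((S.T.ρ k).toLocal v)
        (S.T.red k).toAddMonoidHom continuous_of_discreteTopology
        (fun _ x => S.T.red_equivariant k _ x) 1) = (S.t k).cond v
  /-- T5 (structure): `𝓛 ⊂ 𝓛₀(T)`, `𝓛 ∩ Σ(F) = ∅` [arXiv p. 6 L97–99]; the prime set of every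
  level triple is `𝓛` (`𝓛_s(T) ⊂ 𝓛` for `s ≫ 0` is `LargePrimes`) -/
  L_subset : S.L ⊆ S.T.degreeTwoPrimes p
  L_disjoint : ∀ v ∈ S.L, (Sum.inr v : Place K) ∉ S.Sigma
  primes_eq : ∀ k, (S.t k).primes = S.L
  /-- H.1 on every level (residual presentation `T^{(k)} ↠ T̄ = T/𝔪T`) [arXiv p. 7, L59] -/
  h1 : ∀ k, H1 (R := Rk k) (S.T.ρ k) S.ρbar (S.πbar k)
  πbar_red : ∀ k (y : N (k + 1)), S.πbar k (S.T.red k y) = S.πbar (k + 1) y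
  /-- H.2 for `T` [arXiv p. 7, L61–63] -/
  h2 : S.T.H2Tower p S.cd S.ρbar
  /-- H.3 on every level [arXiv p. 7, L65–67] -/
  h3 : ∀ k, H3 (S.T.ρ k) (Rk k) (S.t k)
  /-- H.4 on every level [arXiv p. 7, L69–82], the pairings compatible under reduction -/
  h4 : ∀ k, (S.D k).IsSelfOrthogonal (S.t k).cond
  e_red : ∀ k (x y : N (k + 1)),
    S.redR k ((S.D (k + 1)).e x y) = (S.D k).e (S.T.red k x) (S.T.red k y)
  /-- H.5 on every level [arXiv p. 7 L93 – p. 8 L1], one `θ` -/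
  θ_eq : ∀ k (x : Nbar), (S.A (k + 1)).θ x = (S.A k).θ x
  h5a : ∀ k, H5a (R := Rk k) (S.A k)
  h5b : ∀ k, H5b (R := Rk k) (S.T.ρ k) (h1 k).1 (S.A k) (S.t k).cond
  h5c : ∀ k, H5c (S.D k) (S.πbar k) (S.A k)
  /-- T7, the finite–singular maps are natural along the reductions (`fsQ` is THE map induced on
  singular quotients; `φ^{fs}` commutes with reduction) [display (ks relations), arXiv p. 6] -/
  fsQ_spec : ∀ k n (v : HeightOneSpectrum (𝓞 K))
      (x : galoisCohomology (GaloisRep.toLocal v ((S.LD (k + 1)).ρq n)) 1),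
    S.fsQ k n v (singularMap _ x) = singularMap _ (S.rqLocH1 k n v x)
  fs_natural : ∀ k n (v : HeightOneSpectrum (𝓞 K))
      (x : galoisCohomology (GaloisRep.toLocal v ((S.LD (k + 1)).ρq n)) 1),
    (S.LD k).fs n v (S.rqLocH1 k n v x) =
      TensorProduct.map (S.fsQ k n v).toIntLinearMap LinearMap.id ((S.LD (k + 1)).fs n v x)
  /-- T7′ (tranche 4), THE PIN of the finite–singular slots: at every level `k`, every `n ∈ 𝓝(𝓛)` and
  `ℓ ∣ λ ∈ n`, `(LD k).fs n λ` is the comparison ISOMORPHISM of Def. 1.1.8 up to the print-derivable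
  ambiguity — bijective on the finite classes and natural in the module
  (`LevelData.IsFsAdmissible`; reading note (v) of `FiniteSingularNatural.lean`)
  [Def. 1.1.8, arXiv p. 5 L126–131; display (ks relations), arXiv p. 6 L126 – p. 7 L12] -/
  fs_admissible : ∀ k, (S.LD k).IsFsAdmissible

/-- **«suppose `𝓛_s(T) ⊂ 𝓛` for `s ≫ 0`»** (T5). [cite: Howard2004HeegnerKolyvagin, §1.6 (arXiv p. 11, L15–16)] -/
def LargePrimes (S : DVRSetting p K R N Rk Nbar Nq) : Prop :=
  ∃ s₀ : ℕ, ∀ s, s₀ ≤ s → S.T.kolyvaginPrimes p s ⊆ S.L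

/-- **A Kolyvagin system `κ ∈ KS(T, F, 𝓛)` for the DVR-level triple** (Def. 1.2.3; T7): at every
level `k` a Kolyvagin system `κ^{(k)} ∈ KS(T^{(k)}, F, 𝓛)` (tranche-2 `LevelData.KS`: the classes
`κ^{(k)}_n ∈ H¹_{F(n)}(K, T^{(k)}/I_n) ⊗ G_n` with the (ks) relations), compatible under the
reductions `T^{(k+1)}/I_n → T^{(k)}/I_n` (`κ_red`) — i.e. `κ_n ∈ H¹_{F(n)}(K, T/I_nT) ⊗ G_n` read at
every level, `T/I_nT = T^{(k)}/I_n` for `e_k ≥ a(n)` — together with the bottom class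
`κ_1 ∈ H¹_F(K, T) = lim` (`one`, `one_mem`) of which `κ^{(k)}_1` is the level-`k` component
(`κ_one`, `I_1 = 0`, `G_1 = ℤ`).  Separate from the setting (LEAD (L5)).
[cite: Howard2004HeegnerKolyvagin, Def. 1.2.3 (arXiv p. 7, L1–12) and §1.6 (arXiv p. 11 L23–24, p. 12 L29–33)] -/
structure KolyvaginSystem (S : DVRSetting p K R N Rk Nbar Nq) where
  /-- the level classes `κ^{(k)}_n` -/
  κ : ∀ k n, ↥((S.LD k).selmerAt S.jbar n) ⊗[ℤ] Gn (K := K) n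
  ks : ∀ k, κ k ∈ (S.LD k).KS S.jbar
  κ_red : ∀ k n,
    TensorProduct.map ((S.rqH1 k n).comp ((S.LD (k + 1)).selmerAt S.jbar n).subtype).toIntLinearMap
        LinearMap.id (κ (k + 1) n) =
      TensorProduct.map ((S.LD k).selmerAt S.jbar n).subtype.toIntLinearMap LinearMap.id (κ k n)
  /-- the bottom class `κ_1 ∈ H¹_F(K, T) = lim_k H¹_F(K, T^{(k)})` -/
  one : ∀ k, galoisCohomology (S.T.ρ k) 1
  one_mem : one ∈ S.T.limitSelmer fun k => (S.t k).cond
  κ_one : ∀ k, TensorProduct.map ((S.LD k).selmerAt S.jbar ∅).subtype.toIntLinearMap LinearMap.id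
      (κ k ∅) =
    ((S.LD k).isQuotientBy ∅).cohomologyMap 1 (one k) ⊗ₜ[ℤ] (gnEmptyEquiv (K := K)).symm 1

/-- **The conclusion of Theorem 1.6.1** on a `DVRSetting`: (i) `H¹_F(K, T)` is free of rank one
over `R`; (ii) there is a finite `R`-module `M` and an `R`-equivariant additive bijection
`H¹_F(K, A) ≅ 𝒟 ⊕ (M ⊕ M)`; (iii) `len_R(M) ≤ len_R(H¹_F(K, T)/R·κ_1)` — with `x` the generator
of (i) and `κ_1 = r₁ x`, `len_R(H¹_F(K,T)/Rκ_1) = len_R(R/r₁R)`.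
[cite: Howard2004HeegnerKolyvagin, Thm. 1.6.1 (arXiv Thm. 2.6.1, p. 11, L23–28)] -/
def Conclusion (S : DVRSetting p K R N Rk Nbar Nq) (hy : S.SatisfiesH)
    (one : ∀ k, galoisCohomology (S.T.ρ k) 1) : Prop :=
  let F : ∀ k, SelmerStructure (S.T.ρ k) := fun k => (S.t k).cond
  let hπ : S.π ∈ IsLocalRing.maximalIdeal R := by
    rw [hy.unif]; exact Ideal.mem_span_singleton_self _
  let he : ∀ k, S.e k ≤ S.e (k + 1) := fun k => (hy.e_strictMono (Nat.lt_succ_self k)).le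
  ∃ x : ∀ k, galoisCohomology (S.T.ρ k) 1,
    S.T.IsFreeRankOneOn (S.T.limitSelmer F) x ∧
    ∃ (M : Type) (_ : AddCommGroup M) (_ : Module R M) (_ : Finite M)
      (Φ : ↥(S.T.selmerA S.π S.e hy.killed hy.ker_red hπ he F) ≃+ (FracModR R × (M × M))),
      (∀ (j : ℕ) (r : R) (c : galoisCohomology (S.T.ρ j) 1)
          (hc : AddCommGroup.DirectLimit.of _ _ j c ∈ S.T.selmerA S.π S.e hy.killed hy.ker_red hπ he F)
          (hrc : AddCommGroup.DirectLimit.of _ _ j (galoisCohomology.scalarMapH1 _ (S.T.hlin j) r c) ∈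
            S.T.selmerA S.π S.e hy.killed hy.ker_red hπ he F),
        Φ ⟨_, hrc⟩ = r • Φ ⟨_, hc⟩) ∧
      ∀ r₁ : R, one = S.T.smulFamily r₁ x →
        Module.length R M ≤ Module.length R (R ⧸ Ideal.span {r₁})

end DVRSetting

/-- **Howard 2004, Theorem 1.6.1 (the discrete-valuation-ring Kolyvagin bound; arXiv Thm. 2.6.1)**,
CITE-ONLY (REF-131): for every `DVRSetting` `S` (R a DVR coefficient ring, `p` odd, `K` imaginary
quadratic, the tower `T` with `(T^{(k)}, F, 𝓛)` on its levels) with `S.SatisfiesH` (H.0–H.5),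
`S.LargePrimes` (`𝓛_s(T) ⊂ 𝓛` for `s ≫ 0`) and a Kolyvagin system `κ : S.KolyvaginSystem` with
`κ_1 ≠ 0`, the `Conclusion` holds: «`H¹_F(K, T)` is a free rank-one
`R`-module, and there is a finite `R`-module `M` such that `H¹_F(K, A) ≅ 𝒟 ⊕ M ⊕ M`.
Furthermore `len_R(M) ≤ len_R(H¹_F(K, T)/R·κ_1)`.»  See the module docstring for the TYPING and
READING NOTES (levelwise hypotheses = Howard's Remark 1.3.1 + §1.6 ¶2; the KS hypothesis is the
family `κ^{(k)}` the proof consumes, its finite–singular comparison maps pinned to Def. 1.1.8 by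
`SatisfiesH.fs_admissible`).
[cite: Howard2004HeegnerKolyvagin, Thm. 1.6.1 (arXiv:1202.6340 Thm. 2.6.1, p. 11 L23–28; proof p. 12 L29–55)] -/
def thm161_dvrKolyvaginBound : Prop :=
  ∀ (p : ℕ) [Fact p.Prime] (K : Type) [Field K] [NumberField K]
    (R : Type) [CommRing R] [IsDomain R] [IsDiscreteValuationRing R] [Algebra ℤ_[p] R]
    (N : ℕ → Type) [∀ k, AddCommGroup (N k)] [∀ k, TopologicalSpace (N k)]
    [∀ k, DiscreteTopology (N k)] [∀ k, Module R (N k)]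
    (Rk : ℕ → Type) [∀ k, CommRing (Rk k)] [∀ k, IsLocalRing (Rk k)] [∀ k, TopologicalSpace (Rk k)]
    [∀ k, DiscreteTopology (Rk k)] [∀ k, Algebra ℤ_[p] (Rk k)] [∀ k, Algebra R (Rk k)]
    [∀ k, Module (Rk k) (N k)] [∀ k, IsScalarTower R (Rk k) (N k)]
    (Nbar : Type) [AddCommGroup Nbar] [TopologicalSpace Nbar] [DiscreteTopology Nbar]
    [∀ k, Module (Rk k) Nbar]
    (Nq : ℕ → Finset (HeightOneSpectrum (𝓞 K)) → Type) [∀ k n, AddCommGroup (Nq k n)]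
    [∀ k n, TopologicalSpace (Nq k n)] [∀ k n, DiscreteTopology (Nq k n)]
    [∀ k n, Module (Rk k) (Nq k n)] [∀ k n, Module R (Nq k n)]
    [∀ k n, IsScalarTower R (Rk k) (Nq k n)]
    (S : DVRSetting p K R N Rk Nbar Nq) (κ : S.KolyvaginSystem) (hy : S.SatisfiesH),
    S.LargePrimes → κ.one ≠ 0 → S.Conclusion hy κ.one

end DVR

end Literature.NumberTheory.GaloisCohomology.Howard2004
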